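import Summits.CriticalPhenomena.PercolationContinuityZ3.Theorems.FK.ContinuityTargets
import Summits.CriticalPhenomena.PercolationContinuityZ3.Theorems.FK.ContinuityQOneBridge
import HarnessLib

/-!
# FK-continuity cell, FO-02 (part 2): the `q = 1` REGRESSION instances of the targets

Helper file of the `fk-continuity` build cell (bschramm lane; `--supports stmt-CriticalPhenomena-4575`): the
corollaries that need BOTH the target definitions (`Theorems/FK/ContinuityTargets.lean`, FO-01) and the `q = 1` bridge
(`Theorems/FK/ContinuityQOneBridge.lean`, FO-02: `θ¹(·,1) = θ⁰(·,1) = θ`, `p_c(1) = p_c(ℤ^d)`).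
builds on p205010 (kernel theorem, internal audit signed; external expert review pending).

* `wired_one_iff_percolationContinuity`, `free_one_iff_percolationContinuity` — T_W(d,1) ↔ T_F(d,1) ↔
  `PercolationContinuity d` (`θ(p_c(ℤ^d)) = 0`); `transfer_one` — T_U(d,1) holds trivially;
* **`wired_one_iff_percolationContinuityZ3 : FKContinuityWired 3 1 ↔ PercolationContinuityZ3`** and
  `free_one_iff_percolationContinuityZ3` — the `q = 1` instances of the cell's targets ARE the summit conjunct
  (regression instance = p205010's statement, SCOPING R4), derived through the bridge, never assumed;
* `percolationContinuityZ3_of_freeAllQ : FKFreeCriticalZ3 → PercolationContinuityZ3`,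
  `percolationContinuityZ3_of_continuityZ3 : FKContinuityZ3 → PercolationContinuityZ3` — the ∀ `q ∋ 1` forms are
  certified STRENGTHENINGS of the summit conjunct (why a route files `FKFreeCriticalZ3Open`, SCOPING §3.9(b));
* `continuityZ3_of_pieces'` — the glue with the summit conjunct itself as the `q = 1` input:
  `FKFreeCriticalZ3Open → FKTransferZ3Open → PercolationContinuityZ3 → FKContinuityZ3`.

Not done here (deliberately): discharging `FKContinuityWired 3 1` from the tree's kernel theorem
`CSH.percolationContinuityZ3_holds` — that import would put this light file on the whole p205010 cone; the cell's
assembly row FO-23 does it in its own file. No definitions, no named facts.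
[cite: Grimmett2006, §5.1 (5.1)–(5.3), Conj. (6.32)] [cite: GrimmettPercolation1999, §1.4 (1.8)]
-/

noncomputable section

namespace Summit.CriticalPhenomena.PercolationContinuityZ3.Theorems

namespace FK

open Literature.Probability.LatticeModels Literature.Barriers.CriticalPhenomena
open Literature.Probability.Percolation

/-- **T_W(d,1) is `PercolationContinuity d`**: at `q = 1` the wired FK target is LITERALLY the percolation
continuity statement `θ(p_c(ℤ^d)) = 0` (`θ¹(·,1) = θ`, `p_c(1) = p_c(ℤ^d)`; FO-02's bridge).
[cite: Grimmett2006, §5.1 (5.1)–(5.3) with §1.2 p. 6] -/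
theorem wired_one_iff_percolationContinuity (d : ℕ) : FKContinuityWired d 1 ↔ PercolationContinuity d :=
  thetaWired_rcCriticalProb_one_eq_zero_iff d

/-- **T_F(d,1) is `PercolationContinuity d`** (`θ⁰(·,1) = θ`; FO-02's bridge).
[cite: Grimmett2006, §5.1 (5.1)–(5.3) with §1.2 p. 6] -/
theorem free_one_iff_percolationContinuity (d : ℕ) : FKContinuityFree d 1 ↔ PercolationContinuity d :=
  thetaFree_rcCriticalProb_one_eq_zero_iff d

/-- At `q = 1` the transfer is trivial (no boundary-condition seam). [cite: Grimmett2006, §5.1 (5.3)] -/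
theorem transfer_one (d : ℕ) : FKTransferAtCritical d 1 := fun hF =>
  (wired_one_iff_percolationContinuity d).2 ((free_one_iff_percolationContinuity d).1 hF)

/-- **Regression instance** (SCOPING R4): `FKContinuityWired 3 1 ↔ PercolationContinuityZ3` — the `q = 1` instance of
the brief's target IS the summit conjunct (the statement p205010 proves), derived through FO-02, never assumed.
[cite: Grimmett2006, §5.1 (5.1)–(5.3)] -/
theorem wired_one_iff_percolationContinuityZ3 : FKContinuityWired 3 1 ↔ _root_.PercolationContinuityZ3 :=
  wired_one_iff_percolationContinuity 3

/-- **Regression instance, free form**: `FKContinuityFree 3 1 ↔ PercolationContinuityZ3`.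
[cite: Grimmett2006, §5.1 (5.1)–(5.3)] -/
theorem free_one_iff_percolationContinuityZ3 : FKContinuityFree 3 1 ↔ _root_.PercolationContinuityZ3 :=
  free_one_iff_percolationContinuity 3

/-- Hence the programme form `FKFreeCriticalZ3` (∀ `q ≥ 1`) is a certified STRENGTHENING of the summit conjunct
(instantiate at `q = 1`) — which is why a route files the open-interval form `FKFreeCriticalZ3Open` (SCOPING §3.9(b)).
[cite: Grimmett2006, Conj. (6.32)(a)] -/
theorem percolationContinuityZ3_of_freeAllQ (h : FKFreeCriticalZ3) : _root_.PercolationContinuityZ3 :=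
  free_one_iff_percolationContinuityZ3.1 (h 1 le_rfl)

/-- Likewise the brief's form `FKContinuityZ3` (`q ∈ [1,2]`, wired) implies the summit conjunct.
[cite: Grimmett2006, Conj. (6.32)] -/
theorem percolationContinuityZ3_of_continuityZ3 (h : FKContinuityZ3) : _root_.PercolationContinuityZ3 :=
  wired_one_iff_percolationContinuityZ3.1 (h 1 le_rfl (by norm_num))

/-- **Glue with the summit conjunct in place of `h1`**: `FKContinuityZ3` from the filing form, the residual, and
`PercolationContinuityZ3` itself (p205010's statement) at `q = 1`. [cite: Grimmett2006, Conj. (6.32) with (6.33)] -/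
theorem continuityZ3_of_pieces' (hF : FKFreeCriticalZ3Open) (hU : FKTransferZ3Open)
    (h1 : _root_.PercolationContinuityZ3) : FKContinuityZ3 :=
  continuityZ3_of_pieces hF hU (wired_one_iff_percolationContinuityZ3.2 h1)

/-- `FKContinuityZ3 ↔ FKFreeCriticalZ3Open ∧ FKTransferZ3Open`-shaped summary, given the summit conjunct: the brief's
target is EQUIVALENT to "filing form + residual" once `q = 1` is settled (the `q = 2` endpoint being a tree theorem).
Forward direction: `freeOpen_of_continuityZ3` and, for `q ∈ (1,2)`, the transfer is read off T_W directly.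
[cite: Grimmett2006, Conj. (6.32) with (6.33)] -/
theorem continuityZ3_iff_pieces (h1 : _root_.PercolationContinuityZ3) :
    FKContinuityZ3 ↔ FKFreeCriticalZ3Open ∧ FKTransferZ3Open :=
  ⟨fun h => ⟨freeOpen_of_continuityZ3 h, fun q hq hq2 _ => h q hq.le hq2.le⟩,
    fun ⟨hF, hU⟩ => continuityZ3_of_pieces' hF hU h1⟩

end FK

end Summit.CriticalPhenomena.PercolationContinuityZ3.Theorems

end
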